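import Summits.BirchSwinnertonDyer.BirchSwinnertonDyer.Theorems.ErratumRoadFiveNonSurjCornerTamagawaExponent
import Literature.NumberTheory.EllipticCurves.LangHeightNonarchEstimate
import HarnessLib

/-!
# Route `ErratumRoadFive` (rung K2), crux `NonSurjCorner` (item stmt-BirchSwinnertonDyer-19065):
# THE CARRIERS OF THE TAMAGAWA EXPONENT `t` ON THE CORNER — `ord_p c_v` place by place; the carriers
# are exactly the split multiplicative places; MONO-carrier (the unique split place carries all of `t`)
# versus MULTI-carrier (⟺ two distinct split multiplicative places) — the hypotheses of the registered
# stubs `stub_kolyJ_max` ∕ `stub_kolyJ_multi` of child 19947 `NonSurjCornerKolyJ` in reduction-type terms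
# (cell `bsd-stepL`, seat `bsd-stepL-corner5-p2` g4, WIDTH-LEVER lane B «class-level road»;
# `--supports stmt-BirchSwinnertonDyer-19065 --as helper`)

WHY THIS FILE. The skeleton of record of child 19947 (`Cruxes/NonSurjCornerKolyJ/Lines/birth.lean`,
corner-p1 g7 reshape, planner g30) cuts the Jetchev direction BY CARRIER PROFILE: `stub_kolyJ_max`
(for every place `v` and every `s ≤ ord_p c_v(E/ℚ) = padicValNat p (W.tamagawaNumberAt v)`) and
`stub_kolyJ_multi` (hypotheses `p ∣ W.tamagawaProduct` and `∀ v, padicValNat p (W.tamagawaNumberAt v) <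
padicValNat p W.tamagawaProduct`: no single place absorbs `t`); `NonSurjCornerKolyJ_of` is the case split
on `∃ v, ord_p ∏c ≤ ord_p c_v`. This file (sequel of `…NonSurjCornerTamagawaExponent`, same seat) computes
these quantities on the corner from the reduction types alone:

* `padicValNat_tamagawaNumberAt_le`, `padicValNat_tamagawaNumberAt_add_le_of_ne` (any `E/ℚ`, any prime):
  `ord_p c_v ≤ ord_p Tam(E)`, and two DISTINCT places contribute additively,
  `ord_p c_v + ord_p c_{v'} ≤ ord_p Tam(E)`; `exists_padicValNat_tamagawaNumberAt_eq_of_not_forall_lt`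
  (¬ multi ⟹ some place carries all of `t` — the skeleton's case logic, recorded);
* `dvd_ordMinimalDiscriminant_of_mult_of_irr_of_not_surj`, `dvd_tamagawaProduct_iff_exists_split_of_mult_of_irr_of_not_surj`
  — the IMAGE-LEVEL forms (`Mult ∧ Irr ∧ ¬Surj`, no rank) of the previous file's corner theorems, so that they
  also cover the rank-0 X11a LEAF TWINS of child 19948: `NonSurjTwin.dvd_tamagawaProduct_iff_exists_split`
  (**`p ∣ ∏c(Wd) ⟺ Wd` has a split multiplicative place** — the Tamagawa factor of `L(Wd,1)/Ω` is a `p`-unit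
  exactly on the all-non-split twins; never on the `a_p = +1` branch `stub_twinMuAn_split`:
  `NonSurjTwin.dvd_tamagawaProduct_of_hasSplitMultiplicativeReductionAtPrime`);
* `NonSurjCorner.one_le_padicValNat_tamagawaNumberAt_of_split`, `NonSurjCorner.dvd_tamagawaNumberAt_iff_split`
  (`p ≥ 5`): **on the corner the carriers of `t` are EXACTLY the split multiplicative places** (`p ∣ c_v ⟺ v`
  split multiplicative; each contributes `ord_p ord_v(Δ_min) ≥ 1`);
* `padicValNat_tamagawaNumberAt_eq_of_unique_split`: **a unique split place `v₀` carries all of `t`** (`ord_p c_{v₀} = ord_p Tam(E)`) — on such pairs `stub_kolyJ_max` at `v₀` delivers every depth `s ≤ t`;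
* `NonSurjCorner.multiCarrier_iff_two_split`: **the two hypotheses of `stub_kolyJ_multi` hold ⟺ `E` has two
  distinct split multiplicative places**; `NonSurjCorner.not_forall_lt_of_subsingleton_split` (the complement).
Census reading (lane A CORNER-G3 §1 ∕ the 19947 skeleton docstring, `p = 5`, `N < 5·10⁵`): multi-carrier =
the 3 pairs with two split places — 84960d1 (`5`, `59`), 296240ce1 (`5`, `7`), 304560by1 (`5`, `47`), all
`t = 1 + 1`; mono-carrier = the other 37 `t ≥ 1` pairs (32 carried by `5` alone, 5 by one split `ℓ ≠ 5`).

HONEST FRAMING: structure theorems (0 definitions, 0 named facts, 0 sorry); nothing here proves the crux,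
a registered stub of 19065 ∕ 19947, or BSD for any class; no census number moves (T7).
References: [SilvermanATAEC1994] Cor. IV.9.2 (d), Table 4.1; [SilvermanAEC2009] VII.6.1, C.16;
[Jetchev2008] §1, Thm. 1.4 (the exponents `ord_p c_q`); tree: `Theorems/ErratumRoadFiveNonSurjCornerTamagawaExponent`
(this seat), `Cruxes/NonSurjCornerKolyJ/Lines/birth.lean` (stubs of record), `LangHeightNonarchEstimate`
(`W.tamagawaNumberAt v`, an `abbrev` of the local factor of `tamagawaProduct`).
-/

set_option linter.dupNamespace false -- `Summit.BirchSwinnertonDyer.BirchSwinnertonDyer` (summit = problem), tree-wide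
set_option autoImplicit false

noncomputable section

open scoped Classical NumberField
open IsDedekindDomain Field WeierstrassCurve

namespace Summit.BirchSwinnertonDyer.BirchSwinnertonDyer.Theorems.CornerLocal

open WeierstrassCurve NumberField Rat.HeightOneSpectrum
  Literature.NumberTheory.EllipticCurves
  Literature.NumberTheory.EllipticCurves.Rank1Residual
  Summit.BirchSwinnertonDyer.Rank1Residual

variable (W : WeierstrassCurve ℚ) [W.IsElliptic] (p : ℕ) [hp : Fact p.Prime]

/-! ### `ord_p c_v` place by place (any `E/ℚ`), then the corner and its twins -/

section Carriers

/-- `c_v = ord_v(Δ_min)` at a split multiplicative place, in the place-indexed currency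
`W.tamagawaNumberAt v` of `stub_kolyJ_max` ∕ `stub_kolyJ_multi` (Kodaira–Néron).
[cite: SilvermanATAEC1994, Cor. IV.9.2 (d)] -/
theorem tamagawaNumberAt_eq_ordMinimalDiscriminant_of_split {v : HeightOneSpectrum (𝓞 ℚ)}
    (hs : W.HasSplitMultiplicativeReductionAt v) : W.tamagawaNumberAt v = W.ordMinimalDiscriminant v :=
  localTamagawaNumber_eq_ordMinimalDiscriminant_of_split W v hs

omit hp in
/-- For `p ≥ 5`: `ord_p c_v = 0` at every place which is not split multiplicative (`1 ≤ c_v ≤ 4`).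
[cite: SilvermanATAEC1994, Cor. IV.9.2 (d)] -/
theorem padicValNat_tamagawaNumberAt_eq_zero_of_not_split (hp5 : 5 ≤ p) {v : HeightOneSpectrum (𝓞 ℚ)}
    (hns : ¬ W.HasSplitMultiplicativeReductionAt v) : padicValNat p (W.tamagawaNumberAt v) = 0 :=
  padicValNat_localTamagawaNumber_eq_zero_of_not_split W p hp5 v hns

/-- `ord_p c_v ≤ ord_p Tam(E)` at every place (`c_v` is a factor of the finite product). Any prime `p`.
[cite: SilvermanAEC2009, C.16 (Tamagawa numbers)] -/
theorem padicValNat_tamagawaNumberAt_le (v : HeightOneSpectrum (𝓞 ℚ)) :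
    padicValNat p (W.tamagawaNumberAt v) ≤ padicValNat p W.tamagawaProduct := by
  have h0 : W.tamagawaProduct ≠ 0 := (W.tamagawaProduct_pos_holds).ne'
  obtain ⟨S, hS⟩ := exists_finset_bad W
  have hdvd : W.tamagawaNumberAt v ∣ W.tamagawaProduct := by
    rw [tamagawaProduct_eq_prod W (insert v S) fun w hw => Finset.mem_insert_of_mem ((hS w).mp hw)]
    exact Finset.dvd_prod_of_mem _ (Finset.mem_insert_self v S)
  rw [← padicValNat_dvd_iff_le h0]
  exact pow_padicValNat_dvd.trans hdvd

/-- **Two distinct places contribute additively**: `ord_p c_v + ord_p c_{v'} ≤ ord_p Tam(E)` for `v ≠ v'`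
(`c_v · c_{v'}` divides the finite product `Tam(E)`). Any prime `p`. [cite: SilvermanAEC2009, C.16 (Tamagawa numbers)] -/
theorem padicValNat_tamagawaNumberAt_add_le_of_ne {v v' : HeightOneSpectrum (𝓞 ℚ)} (hvv' : v ≠ v') :
    padicValNat p (W.tamagawaNumberAt v) + padicValNat p (W.tamagawaNumberAt v') ≤
      padicValNat p W.tamagawaProduct := by
  have h0 : W.tamagawaProduct ≠ 0 := (W.tamagawaProduct_pos_holds).ne'
  obtain ⟨S, hS⟩ := exists_finset_bad W
  have hsub : ({v, v'} : Finset (HeightOneSpectrum (𝓞 ℚ))) ⊆ insert v (insert v' S) := by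
    intro w hw
    simp only [Finset.mem_insert, Finset.mem_singleton] at hw
    rcases hw with rfl | rfl
    · exact Finset.mem_insert_self _ _
    · exact Finset.mem_insert_of_mem (Finset.mem_insert_self _ _)
  have hdvd : W.tamagawaNumberAt v * W.tamagawaNumberAt v' ∣ W.tamagawaProduct := by
    rw [tamagawaProduct_eq_prod W (insert v (insert v' S)) fun w hw =>
      Finset.mem_insert_of_mem (Finset.mem_insert_of_mem ((hS w).mp hw))]
    have key : (∏ w ∈ ({v, v'} : Finset (HeightOneSpectrum (𝓞 ℚ))), W.tamagawaNumberAt w) ∣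
        ∏ w ∈ insert v (insert v' S), W.tamagawaNumberAt w :=
      Finset.prod_dvd_prod_of_subset _ _ _ hsub
    rwa [Finset.prod_pair hvv'] at key
  rw [← padicValNat.mul (W.localTamagawaNumber_baseChange_ne_zero v)
    (W.localTamagawaNumber_baseChange_ne_zero v'), ← padicValNat_dvd_iff_le h0]
  exact pow_padicValNat_dvd.trans hdvd

/-- If NO place satisfies `ord_p c_v < ord_p Tam(E)` for all `v` — i.e. the multi-carrier hypothesis of
`stub_kolyJ_multi` fails — then some place carries all of `t`: `ord_p c_v = ord_p Tam(E)` (every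
`ord_p c_v ≤ ord_p Tam(E)`). Pure bookkeeping, any prime. [cite: SilvermanAEC2009, C.16 (Tamagawa numbers)] -/
theorem exists_padicValNat_tamagawaNumberAt_eq_of_not_forall_lt
    (h : ¬ ∀ v : HeightOneSpectrum (𝓞 ℚ),
      padicValNat p (W.tamagawaNumberAt v) < padicValNat p W.tamagawaProduct) :
    ∃ v : HeightOneSpectrum (𝓞 ℚ), padicValNat p (W.tamagawaNumberAt v) = padicValNat p W.tamagawaProduct := by
  push Not at h
  obtain ⟨v, hv⟩ := h
  exact ⟨v, le_antisymm (padicValNat_tamagawaNumberAt_le W p v) hv⟩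


/-- **MONO-carrier pairs: a unique split multiplicative place carries all of `t`** (any `E/ℚ`, `p ≥ 5`):
if `v₀` is split multiplicative and no other place is, then `ord_p c_{v₀} = ord_p Tam(E)` — so on such a
corner pair the MAX form `stub_kolyJ_max` at `v₀` already delivers every depth `s ≤ t` (lane A's count: 37
of the 40 `t ≥ 1` census pairs at `p = 5`). [cite: SilvermanATAEC1994, Cor. IV.9.2 (d) and Table 4.1] [cite: Jetchev2008, §1, Thm. 1.4] -/
theorem padicValNat_tamagawaNumberAt_eq_of_unique_split (hp5 : 5 ≤ p)
    {v₀ : HeightOneSpectrum (𝓞 ℚ)} (hs : W.HasSplitMultiplicativeReductionAt v₀)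
    (huniq : ∀ v, W.HasSplitMultiplicativeReductionAt v → v = v₀) :
    padicValNat p (W.tamagawaNumberAt v₀) = padicValNat p W.tamagawaProduct := by
  obtain ⟨S, hS⟩ := exists_finset_bad W
  have hS' : ∀ v, W.ordMinimalDiscriminant v ≠ 0 → v ∈ insert v₀ S :=
    fun w hw => Finset.mem_insert_of_mem ((hS w).mp hw)
  rw [padicValNat_tamagawaProduct_eq_sum W p hp5 (insert v₀ S) hS',
    Finset.sum_eq_single_of_mem v₀ (Finset.mem_insert_self v₀ S) fun v _ hv => ?_]
  · rw [if_pos hs, tamagawaNumberAt_eq_ordMinimalDiscriminant_of_split W hs]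
  · rw [if_neg fun h => hv (huniq v h)]

/-! ### The image-level forms (`Mult ∧ Irr ∧ ¬Surj`, any odd `p`): corner pairs AND their X11a leaf twins -/

section ImageForm

variable [W.IsGloballyMinimal]

/-- **`p ∣ ord_v(Δ_min)` at every multiplicative place, image-level form**: for `W/ℚ` globally minimal,
`p` odd multiplicative with `E[p]` irreducible and `ρ̄_{E,p}` NOT onto (the hypotheses shared by the corner
`ClassX11b ∧ ¬Surj` and its rank-0 leaf twins `ClassX11a ∧ ¬Surj` of child 19948), every multiplicative
place `v` has `p ∣ ord_v(Δ_min)` — at `v ∣ p` by x11c gen 8 (`GaloisImage.surj_of_mult_of_irr_of_not_dvd`: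
très ramifié would make `ρ̄` onto), at `v ∤ p` by `Rank1Residual.not_ram_of_irr_of_not_surj` (unramified at `ℓ`).
[cite: Serre1972, §2.4 Prop. 15, §5.4] [cite: SilvermanATAEC1994, V.6 Prop. 6.1] -/
theorem dvd_ordMinimalDiscriminant_of_mult_of_irr_of_not_surj (hp2 : p ≠ 2) (hmult : Mult W p)
    (hirr : Irr W p) (hns : ¬ Surj W p) {v : HeightOneSpectrum (𝓞 ℚ)}
    (hm : W.HasMultiplicativeReductionAt v) : p ∣ W.ordMinimalDiscriminant v := by
  rw [ordMinimalDiscriminant_eq_padicValInt_primesEquiv W v]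
  by_cases hv : (primesEquiv v : ℕ) = p
  · rw [hv]
    by_contra hnd
    exact hns (GaloisImage.surj_of_mult_of_irr_of_not_dvd W p hp2 hmult hirr hnd)
  · by_contra hnd
    haveI : Fact (primesEquiv v : ℕ).Prime := ⟨(primesEquiv v).2⟩
    exact not_ram_of_irr_of_not_surj W p hirr hns ⟨(primesEquiv v : ℕ), inferInstance, hv,
      (W.hasMultiplicativeReductionAtPrime_iff_hasMultiplicativeReductionAt_ringOfIntegers v).mpr hm,
      hnd⟩

/-- **Image-level form of `t ≥ 1 ⟺ a split multiplicative place`** (`p ≥ 5`, `Mult ∧ Irr ∧ ¬Surj`).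
[cite: SilvermanATAEC1994, Cor. IV.9.2 (d) and Table 4.1] -/
theorem dvd_tamagawaProduct_iff_exists_split_of_mult_of_irr_of_not_surj (hmult : Mult W p)
    (hirr : Irr W p) (hns : ¬ Surj W p) (hp5 : 5 ≤ p) :
    p ∣ W.tamagawaProduct ↔ ∃ v : HeightOneSpectrum (𝓞 ℚ), W.HasSplitMultiplicativeReductionAt v := by
  have hp2 : p ≠ 2 := by omega
  rw [CornerLocal.dvd_tamagawaProduct_iff_exists_split W p hp5]
  exact ⟨fun ⟨v, hs, _⟩ => ⟨v, hs⟩, fun ⟨v, hs⟩ => ⟨v, hs,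
    dvd_ordMinimalDiscriminant_of_mult_of_irr_of_not_surj W p hp2 hmult hirr hns
      hs.hasMultiplicativeReductionAt⟩⟩

/-- **The X11a leaf TWINS of the corner (child 19948 `NonSurjCornerTwinMuAn`): `p ∣ ∏_ℓ c_ℓ(Wd) ⟺ Wd`
has a split multiplicative place** (`p ≥ 5`). So the Tamagawa factor of the rank-0 BSD value
`L(Wd,1)/Ω = #Ш·∏c_ℓ/#tors²` is prime to `p` exactly on the twins all of whose multiplicative primes are
non-split — in particular never on the `a_p = +1` branch `stub_twinMuAn_split`; the unit-value locus of
`…TwinMuAnUnitValue` (corner-p1 g7) lies inside the `a_p = −1`, no-split-`ℓ` twins.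
[cite: SilvermanATAEC1994, Cor. IV.9.2 (d) and Table 4.1] [cite: MazurTateTeitelbaum1986, §I.10 (allowable root a_p = ±1)] -/
theorem NonSurjTwin.dvd_tamagawaProduct_iff_exists_split (hXa : ClassX11a W p) (hns : ¬ Surj W p)
    (hp5 : 5 ≤ p) :
    p ∣ W.tamagawaProduct ↔ ∃ v : HeightOneSpectrum (𝓞 ℚ), W.HasSplitMultiplicativeReductionAt v :=
  dvd_tamagawaProduct_iff_exists_split_of_mult_of_irr_of_not_surj W p hXa.2.2.1 hXa.2.2.2.1 hns hp5

/-- The twin form of «split at `p` forces `p ∣ ∏c`»: an X11a leaf twin on the `a_p = +1` branch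
(`HasSplitMultiplicativeReductionAtPrime p`, stub `stub_twinMuAn_split`) has `p ∣ ∏_ℓ c_ℓ(Wd)` (indeed
`p ∣ c_p = ord_p Δ_min(Wd)`), any odd `p`. [cite: SilvermanATAEC1994, Cor. IV.9.2 (d)] -/
theorem NonSurjTwin.dvd_tamagawaProduct_of_hasSplitMultiplicativeReductionAtPrime (hXa : ClassX11a W p)
    (hns : ¬ Surj W p) (hs : W.HasSplitMultiplicativeReductionAtPrime p) : p ∣ W.tamagawaProduct := by
  set v : HeightOneSpectrum (𝓞 ℚ) := (primesEquiv (R := 𝓞 ℚ)).symm ⟨p, hp.out⟩ with hvdef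
  have hv : primesEquiv v = ⟨p, hp.out⟩ := Equiv.apply_symm_apply _ _
  have key : ∀ q : Nat.Primes, primesEquiv v = q →
      (haveI := Fact.mk q.2; W.HasSplitMultiplicativeReductionAtPrime (q : ℕ)) →
        W.HasSplitMultiplicativeReductionAt v := by
    rintro q rfl h
    exact (hasSplitMultiplicativeReductionAtPrime_iff_hasSplitMultiplicativeReductionAt W v).mp h
  have hs' : W.HasSplitMultiplicativeReductionAt v := key ⟨p, hp.out⟩ hv hs
  exact dvd_tamagawaProduct_of_split_of_dvd W p hs'
    (dvd_ordMinimalDiscriminant_of_mult_of_irr_of_not_surj W p hXa.2.1 hXa.2.2.1 hXa.2.2.2.1 hns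
      hs'.hasMultiplicativeReductionAt)

end ImageForm

variable [W.IsGloballyMinimal]

/-- **On the corner every split multiplicative place is a CARRIER: `ord_p c_v ≥ 1`** (`c_v = ord_v Δ_min`,
divisible by `p` by `NonSurjCorner.dvd_ordMinimalDiscriminant_of_hasMultiplicativeReductionAt`). Any prime.
[cite: SilvermanATAEC1994, Cor. IV.9.2 (d)] [cite: Jetchev2008, §1] -/
theorem NonSurjCorner.one_le_padicValNat_tamagawaNumberAt_of_split (hX : ClassX11b W p) (hns : ¬ Surj W p)
    {v : HeightOneSpectrum (𝓞 ℚ)} (hs : W.HasSplitMultiplicativeReductionAt v) :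
    1 ≤ padicValNat p (W.tamagawaNumberAt v) := by
  have h0 : W.ordMinimalDiscriminant v ≠ 0 :=
    ordMinimalDiscriminant_ne_zero_of_hasMultiplicativeReductionAt v W hs.hasMultiplicativeReductionAt
  rw [tamagawaNumberAt_eq_ordMinimalDiscriminant_of_split W hs, ← padicValNat_dvd_iff_le h0, pow_one]
  exact NonSurjCorner.dvd_ordMinimalDiscriminant_of_hasMultiplicativeReductionAt W p hX hns
    hs.hasMultiplicativeReductionAt

/-- **On the corner (`p ≥ 5`) the carriers of `t` are EXACTLY the split multiplicative places:
`p ∣ c_v ⟺ v` split multiplicative.** [cite: SilvermanATAEC1994, Cor. IV.9.2 (d) and Table 4.1] -/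
theorem NonSurjCorner.dvd_tamagawaNumberAt_iff_split (hX : ClassX11b W p) (hns : ¬ Surj W p) (hp5 : 5 ≤ p)
    (v : HeightOneSpectrum (𝓞 ℚ)) : p ∣ W.tamagawaNumberAt v ↔ W.HasSplitMultiplicativeReductionAt v := by
  refine ⟨fun h => ?_, fun hs => dvd_of_one_le_padicValNat
    (NonSurjCorner.one_le_padicValNat_tamagawaNumberAt_of_split W p hX hns hs)⟩
  by_contra hns'
  have h1 : 1 ≤ padicValNat p (W.tamagawaNumberAt v) := by
    rw [← padicValNat_dvd_iff_le (W.localTamagawaNumber_baseChange_ne_zero v), pow_one]; exact h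
  have h2 := padicValNat_tamagawaNumberAt_eq_zero_of_not_split W p hp5 hns'
  omega

/-- **MULTI-carrier corner pairs are exactly those with TWO distinct split multiplicative places**
(`p ≥ 5`): the pair of hypotheses of the registered stub `stub_kolyJ_multi` of child 19947 —
`p ∣ Tam(E)` and `ord_p c_v < ord_p Tam(E)` for EVERY place `v` — holds iff `E` is split multiplicative
at two distinct places (census at `p = 5`, `N < 5·10⁵`: 3 of 64 pairs — 84960d1 (`5`, `59`), 296240ce1
(`5`, `7`), 304560by1 (`5`, `47`), all with `t = 2 = 1 + 1`). (⇒) a split place exists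
(`NonSurjCorner.dvd_tamagawaProduct_iff_exists_split`); were it the only one it would carry all of `t`
(`padicValNat_tamagawaNumberAt_eq_of_unique_split`). (⇐) both places are carriers (`ord_p c ≥ 1`) and two distinct carriers
contribute additively. [cite: SilvermanATAEC1994, Cor. IV.9.2 (d) and Table 4.1] [cite: Jetchev2008, §1] -/
theorem NonSurjCorner.multiCarrier_iff_two_split (hX : ClassX11b W p) (hns : ¬ Surj W p) (hp5 : 5 ≤ p) :
    (p ∣ W.tamagawaProduct ∧ ∀ v : HeightOneSpectrum (𝓞 ℚ),
        padicValNat p (W.tamagawaNumberAt v) < padicValNat p W.tamagawaProduct) ↔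
      ∃ v₁ v₂ : HeightOneSpectrum (𝓞 ℚ), v₁ ≠ v₂ ∧
        W.HasSplitMultiplicativeReductionAt v₁ ∧ W.HasSplitMultiplicativeReductionAt v₂ := by
  constructor
  · rintro ⟨hdvd, hlt⟩
    obtain ⟨v₁, hs₁⟩ := (NonSurjCorner.dvd_tamagawaProduct_iff_exists_split W p hX hns hp5).mp hdvd
    by_contra hne
    push Not at hne
    have huniq : ∀ v, W.HasSplitMultiplicativeReductionAt v → v = v₁ := fun v hv => by
      by_contra h
      exact hne v₁ v (Ne.symm h) hs₁ hv
    exact (hlt v₁).ne (padicValNat_tamagawaNumberAt_eq_of_unique_split W p hp5 hs₁ huniq)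
  · rintro ⟨v₁, v₂, hne, hs₁, hs₂⟩
    refine ⟨NonSurjCorner.dvd_tamagawaProduct_of_split W p hX hns hs₁, fun v => ?_⟩
    have h₁ := NonSurjCorner.one_le_padicValNat_tamagawaNumberAt_of_split W p hX hns hs₁
    have h₂ := NonSurjCorner.one_le_padicValNat_tamagawaNumberAt_of_split W p hX hns hs₂
    by_cases hv : v = v₁
    · subst hv
      have := padicValNat_tamagawaNumberAt_add_le_of_ne W p hne
      omega
    · have := padicValNat_tamagawaNumberAt_add_le_of_ne W p hv
      omega

/-- **The complement: at most one split multiplicative place ⟹ NOT multi-carrier** (`p ≥ 5`), and then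
(if `p ∣ Tam(E)` at all) the unique split place `v₀` has `ord_p c_{v₀} = t` — the case served by
`stub_kolyJ_max`. Stated as: `(∀ v v', split v → split v' → v = v')` implies
`¬ ∀ v, ord_p c_v < ord_p Tam(E)` whenever `p ∣ Tam(E)`. [cite: SilvermanATAEC1994, Cor. IV.9.2 (d) and Table 4.1] -/
theorem NonSurjCorner.not_forall_lt_of_subsingleton_split (hX : ClassX11b W p) (hns : ¬ Surj W p)
    (hp5 : 5 ≤ p) (hdvd : p ∣ W.tamagawaProduct)
    (hsub : ∀ v v' : HeightOneSpectrum (𝓞 ℚ), W.HasSplitMultiplicativeReductionAt v →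
      W.HasSplitMultiplicativeReductionAt v' → v = v') :
    ¬ ∀ v : HeightOneSpectrum (𝓞 ℚ),
      padicValNat p (W.tamagawaNumberAt v) < padicValNat p W.tamagawaProduct := by
  intro hlt
  obtain ⟨v₁, v₂, hne, hs₁, hs₂⟩ :=
    (NonSurjCorner.multiCarrier_iff_two_split W p hX hns hp5).mp ⟨hdvd, hlt⟩
  exact hne (hsub v₁ v₂ hs₁ hs₂)

end Carriers

end Summit.BirchSwinnertonDyer.BirchSwinnertonDyer.Theorems.CornerLocal

end
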